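import Summits.QuantumFields.BalabanUV.T4Continuum.Support.NE3TopRadiusLetters
import Summits.QuantumFields.BalabanUV.T4Continuum.Support.NE3CovariantLineSumsL2Tower
import HarnessLib

/-!
# NE3TopRadiusLettersL2 (T⁴ programme, node NE3, row NE3-R2 — junction reader of route H♮, kernel K-g10-2) — THE ℓ²-DEFECT LEVEL SUM
# `S2sum` IS DOMINATED BY ITS TOP LEVEL, HENCE BY THE REGIME'S ε

Row NE3-R2 OWNER lineage `b2b-balaban-t4-ne3r2-p1` (gen 10).  Companion of `NE3TopRadiusLetters` (K-g10-1) for the ONE remaining letter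
of the K6 assembly that is a level SUM: C1's `S2sum d L (k+1) x = Σ_{i ≤ k} delta2 d L r_i` (`NE3CovariantLineSumsL2Tower`; it enters
K6b-3's `weightedEnergy_nonexact_le` squared and is the class hypothesis `S2sum ≤ rho∕2` of K6c-1a `NE3SlicePoincareEtaBound.eta_sq_le`
and of H4-W).  Like `DSum` (`NE3ExactLineSumsTower.DSum_le_top`) and `Ssum` (`NE3CovariantLineSumsError.Ssum_le_top`) it is
geometric from the TOP for `L ≥ 2` (the radii grow by `≥ L² ≥ 4` per level, `delta2` is linear in the radius), so
(all [folklore], real-number bookkeeping, 0 def, 0 sorry):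
§1 `four_mul_delta2_le` (`4·delta2 x ≤ delta2 (prop1Radius x)`), **`S2sum_le_top`** (`S2sum d L (j+1) x ≤ (4∕3)·delta2 d L r_j − (1∕3)·delta2 d L x`);
§2 with K-g10-1's `iterate_prop1Radius_le_of_levelSmall`: **`delta2_iterate_le_of_levelSmall`** (`delta2 d L r_j ≤ 17(d+1)(d+4)√C2sq·(L^{j+1})²x`)
   and **`S2sum_le_of_levelSmall`** (`S2sum d L (j+1) x ≤ (68∕3)(d+1)(d+4)·√(C2sq d L)·(L^{j+1})²x`) — so the hypothesis `S2sum ≤ rho∕2`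
   is ONE displayed line on θ₁ = (L^{j+1})²x (= the class radius ε up to 1∕16 at the junction, K-g10-1 §4): `(68∕3)(d+1)(d+4)√C2sq·θ₁ ≤ rho d L∕2`
   (`S2sum_le_half_rho_of_le`).  NOT implied by `LevelSmall` (√C2sq is a box-counting constant ≈ 3·10¹¹ at d = 4, L = 2): it stays a line.
HONEST FRAMING.  Arithmetic of OUR averaging radii; nothing about Bałaban's minimisers; (P♮)_W, (ML_w) at `W ≠ 1`, T-E_w and NE3 are NOT
proved; spine PROVED 0∕9; finite T⁴ rung (B)+1 — NOT infinite volume, NOT mass gap, NOT BetaPertH, NOT Clay.  ABSOLUTE RULE kept (no printed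
sentence is a hypothesis).  PLACEMENT: `Summits/QuantumFields/BalabanUV/`; imports accepted modules only; moves nothing.  HONEST DEPENDENCY:
continuum YM on T⁴ ⇐ BetaPertH ∧ nine spine estimates (0/9 proved); BetaPertH ⇐ (D1) ∧ (D4) ∧ CAP+tail; G-an2-4 gates asym, D1 and NE2/3/4.
-/

set_option autoImplicit false

namespace Summit.QuantumFields.BalabanUV.T4Continuum.NE3TopRadiusLettersL2

open Literature.MathematicalPhysics.QuantumFieldTheory.Balaban1983to89
open AveragingDeficitTwoLevelPrep (twoLevelSmall prop1Radius)
open AveragingDeficitMultiLevelPrep (LevelSmall prop1Radius_nonneg)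
open NE3CovariantLineSumsError (sq_mul_le_prop1Radius iterate_prop1Radius_nonneg)
open NE3CovariantLineSumsL2 (C2sq)
open NE3CovariantLineSumsL2Tower (rho delta2 S2sum S2sum_succ delta2_nonneg S2sum_nonneg)
open NE3TopRadiusLetters (iterate_prop1Radius_le_of_levelSmall)

noncomputable section

variable {d : ℕ}

/-! ## §1 `S2sum` is dominated by its top level -/

/-- `delta2` is linear in the radius: `delta2 d L x = (16(d+1)(d+4)L²·√C2sq)·x`. [folklore] -/
theorem delta2_eq_mul (L : ℕ) (x : ℝ) :
    delta2 d L x = (16 * ((d : ℝ) + 1) * ((d : ℝ) + 4) * (L : ℝ) ^ 2 * Real.sqrt (C2sq d L)) * x := by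
  unfold delta2; ring

/-- `delta2` is monotone in the radius. [folklore] -/
theorem delta2_mono (L : ℕ) {x y : ℝ} (hxy : x ≤ y) : delta2 d L x ≤ delta2 d L y := by
  rw [delta2_eq_mul, delta2_eq_mul]
  have hc : 0 ≤ 16 * ((d : ℝ) + 1) * ((d : ℝ) + 4) * (L : ℝ) ^ 2 * Real.sqrt (C2sq d L) := by
    have := Real.sqrt_nonneg (C2sq d L); positivity
  exact mul_le_mul_of_nonneg_left hxy hc

/-- For `L ≥ 2` and `x ≥ 0`: `4·delta2 x ≤ delta2 (prop1Radius x)` (`prop1Radius x ≥ L²x ≥ 4x`). [folklore] -/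
theorem four_mul_delta2_le {L : ℕ} (hL : 2 ≤ L) {x : ℝ} (hx : 0 ≤ x) : 4 * delta2 d L x ≤ delta2 d L (prop1Radius d L x) := by
  have hL2 : (4 : ℝ) ≤ (L : ℝ) ^ 2 := by
    have : (2 : ℝ) ≤ L := by exact_mod_cast hL
    nlinarith
  have hp := sq_mul_le_prop1Radius (d := d) L x
  have h4 : 4 * x ≤ prop1Radius d L x := le_trans (by nlinarith) hp
  have h := delta2_mono (d := d) L h4
  rw [delta2_eq_mul (d := d) L (4 * x)] at h
  rw [delta2_eq_mul (d := d) L x]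
  linarith

/-- **GEOMETRIC DOMINATION BY THE TOP LEVEL** (`L ≥ 2`, `x ≥ 0`):
`S2sum d L (j+1) x ≤ (4∕3)·delta2 d L ((prop1Radius d L)^[j] x) − (1∕3)·delta2 d L x`. [folklore] -/
theorem S2sum_le_top {L : ℕ} (hL : 2 ≤ L) : ∀ (j : ℕ) {x : ℝ}, 0 ≤ x →
    S2sum d L (j + 1) x ≤ 4 / 3 * delta2 d L ((prop1Radius d L)^[j] x) - 1 / 3 * delta2 d L x
  | 0, x, _ => by
      rw [S2sum_succ]
      simp only [S2sum, add_zero, Function.iterate_zero, id_eq]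
      linarith
  | j + 1, x, hx => by
      rw [S2sum_succ, Function.iterate_succ_apply]
      have hx1 : 0 ≤ prop1Radius d L x := prop1Radius_nonneg (d := d) (L := L) hx
      have ih := S2sum_le_top hL j hx1
      have h4 := four_mul_delta2_le (d := d) hL hx
      linarith

/-! ## §2 In the coarse letter -/

/-- **THE TOP ℓ²-DEFECT IN THE COARSE LETTER** (`L ≥ 2`, `x ≥ 0`): `LevelSmall d L j x ⇒
delta2 d L ((prop1Radius d L)^[j] x) ≤ 17(d+1)(d+4)·√(C2sq d L)·((L^{j+1})²·x)`. [folklore] -/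
theorem delta2_iterate_le_of_levelSmall {L : ℕ} (hL : 2 ≤ L) (j : ℕ) {x : ℝ} (hx : 0 ≤ x) (hs : LevelSmall d L j x) :
    delta2 d L ((prop1Radius d L)^[j] x)
      ≤ 17 * (((d : ℝ) + 1) * ((d : ℝ) + 4)) * Real.sqrt (C2sq d L) * (((L : ℝ) ^ (j + 1)) ^ 2 * x) := by
  have h := iterate_prop1Radius_le_of_levelSmall hL j hx hs
  rw [delta2_eq_mul]
  have hC := Real.sqrt_nonneg (C2sq d L)
  have hc : 0 ≤ 16 * ((d : ℝ) + 1) * ((d : ℝ) + 4) * (L : ℝ) ^ 2 * Real.sqrt (C2sq d L) := by positivity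
  calc (16 * ((d : ℝ) + 1) * ((d : ℝ) + 4) * (L : ℝ) ^ 2 * Real.sqrt (C2sq d L)) * (prop1Radius d L)^[j] x
      ≤ (16 * ((d : ℝ) + 1) * ((d : ℝ) + 4) * (L : ℝ) ^ 2 * Real.sqrt (C2sq d L)) * (17 / 16 * (((L : ℝ) ^ 2) ^ j * x)) :=
        mul_le_mul_of_nonneg_left h hc
    _ = 17 * (((d : ℝ) + 1) * ((d : ℝ) + 4)) * Real.sqrt (C2sq d L) * (((L : ℝ) ^ (j + 1)) ^ 2 * x) := by ring

/-- **`S2sum` IN THE COARSE LETTER** (`L ≥ 2`, `x ≥ 0`): `LevelSmall d L j x ⇒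
S2sum d L (j+1) x ≤ (68∕3)(d+1)(d+4)·√(C2sq d L)·((L^{j+1})²·x)` — k-FREE. [folklore] -/
theorem S2sum_le_of_levelSmall {L : ℕ} (hL : 2 ≤ L) (j : ℕ) {x : ℝ} (hx : 0 ≤ x) (hs : LevelSmall d L j x) :
    S2sum d L (j + 1) x
      ≤ 68 / 3 * (((d : ℝ) + 1) * ((d : ℝ) + 4)) * Real.sqrt (C2sq d L) * (((L : ℝ) ^ (j + 1)) ^ 2 * x) := by
  have h1 := S2sum_le_top (d := d) hL j hx
  have h2 := delta2_iterate_le_of_levelSmall hL j hx hs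
  have h3 : 0 ≤ delta2 d L x := delta2_nonneg d L hx
  linarith

/-- **THE CLASS LINE `S2sum ≤ rho∕2` FROM ONE DISPLAYED ε-LINE** (`L ≥ 2`, `x ≥ 0`, `LevelSmall d L j x`):
`(68∕3)(d+1)(d+4)·√(C2sq d L)·((L^{j+1})²·x) ≤ rho d L∕2 ⇒ S2sum d L (j+1) x ≤ rho d L∕2` — the hypothesis `hS2` of K6c-1a ∕ H4-W ∕ K6b-3
discharged from a k-free line on θ₁. [folklore] -/
theorem S2sum_le_half_rho_of_le {L : ℕ} (hL : 2 ≤ L) (j : ℕ) {x : ℝ} (hx : 0 ≤ x) (hs : LevelSmall d L j x)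
    (hθ : 68 / 3 * (((d : ℝ) + 1) * ((d : ℝ) + 4)) * Real.sqrt (C2sq d L) * (((L : ℝ) ^ (j + 1)) ^ 2 * x) ≤ rho d L / 2) :
    S2sum d L (j + 1) x ≤ rho d L / 2 :=
  (S2sum_le_of_levelSmall hL j hx hs).trans hθ

end

end Summit.QuantumFields.BalabanUV.T4Continuum.NE3TopRadiusLettersL2
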